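import Literature.AlgebraicGeometry.ShimuraVarieties.UnitaryShimuraCurveRecordSignature
import Literature.AlgebraicGeometry.ShimuraVarieties.UnitaryShimuraCurveRecordDiscrete
import Literature.NumberTheory.Automorphic.UnitaryGroupTwoIndefinitePlacesNotDiscrete
import Literature.NumberTheory.Automorphic.UnitaryGroupEllipticGeneratorBounded
import Literature.NumberTheory.Automorphic.UnitaryGroupLevelBasis
import Literature.NumberTheory.Automorphic.UnitaryGroupArithmeticLevels
import Mathlib.NumberTheory.NumberField.CMField
import HarnessLib

/-!
# The signature datum of a unitary Shimura-curve record (upstream closer of the E-line socket `stub_SIG`)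

Topic `Literature/AlgebraicGeometry/ShimuraVarieties`, namespace
`Literature.AlgebraicGeometry.ShimuraVarieties.UnitaryCanonicalModel`.  Cell `hodgecm-mathlib`, FLOOR 0, crux item
stmt-HodgeConjecture-24832 (hLiu418), E-line `Cruxes/HLiu418/Lines/F0_P6a_PELWitnessE.lean`, socket
`stub_SIG : RecordSignatureDatumOfSystem` (LEAD heir F0P6-plan (g3) «M-42»; line L5 of GO 500, closer skeleton∕leaf LA5-plan (g0),
organs LA5-p01 (g0) ∕ LA5-p02 (g0)).  THEOREMS ONLY (no definition, no named fact, no instance, no `sorry`).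

THE PRINT.  [Liu2021] App. C §C.1 p. 107 and Rem. C.2 p. 108: the hermitian space of a unitary Shimura variety has signature
`(n − 1, 1)` at `τ` and `(n, 0)` at the other archimedean places (here `n = 2`); [RapoportSmithlingZhang2020Diagonal] §3.1 p. 8.
For the rank-2 record ★ `UnitaryCanonicalModel.RecordSystemGS L J⋆ τ K₀` ([Deligne1979ShimuraVarieties] 2.1.2: the complex curve
is a disjoint sum of arithmetic ball quotients) this signature is NOT a hypothesis but a CONSEQUENCE of the record's pieces:
* (1,1) at `τ` and positivity at every `σ` reading `J⋆` neither as `τ` nor as `τ̄` — ★ `UnitaryShimuraCurveRecordSignature`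
  (`RecordSystemGS.exists_sigDatum_one_of_forall_ne`, from the ball data `(B q).signature_τ₁`, `(B q).posDef_of_ne`);
* «case (3) is empty»: no `σ` off the place of `τ` reads `J⋆` as `τ` or `τ̄` does — for such a `σ` the form `J⋆` would be
  indefinite at TWO real places of `L⁺`, its principal congruence subgroups would contain infinitely many `τ`-bounded elements
  (★ `UnitaryGroupTwoIndefinitePlacesNotDiscrete`: Dirichlet's unit theorem in a quadratic order, [Neukirch1999] Ch. I (7.4);
  ★ `UnitaryGroupEllipticGeneratorBounded`), whereas the record's levels are DISCRETE at `τ` (★ `UnitaryShimuraCurveRecordDiscrete`,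
  [Borel1969] Prop. 7.13) — contradiction.

WHAT IS PROVED.  For a record `S : RecordSystemGS L J⋆ τ K₀`, any small level `Kc`, and `J⋆` hermitian (`(J⋆^c)ᵀ = J⋆`):
* `RecordSystemGS.map_ne_and_map_ne_conjugate_of_mk_ne` — «case (3) = ∅»: every complex embedding `σ` off the place of `τ` has
  `J⋆^σ ≠ J⋆^τ` and `J⋆^σ ≠ J⋆^τ̄` (the residual hypothesis of ★ `exists_sigDatum_one_of_forall_ne`).
* `RecordSystemGS.exists_sigDatum` — THE SIGNATURE DATUM: `∃ t : L` (namely `t = 1`), `τ t` real positive, `t•J⋆` of signature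
  `(1,1)` at `τ` and positive definite at every `σ` off the place of `τ` — VERBATIM the body of the E-line's `SigDatum L τ J⋆`, so the
  E-line pays `theorem stub_SIG : RecordSignatureDatumOfSystem := fun F _ _ _ _ ι₁ Jstar hJ _hJu K₀ S Kc => S.exists_sigDatum Kc hJ`.
The glue lemmas (conjugate frames, `det (Tᴴ J T) = |det T|²·det J`, `det H_{1,1} = −1`) are the L5 leaf's §2, kept private.
HC_CM is proved only modulo the printed citations until rung 0 closes; this file discharges no named fact.
-/

set_option autoImplicit false

noncomputable section

open Function MulAction NumberField Matrix
open scoped Matrix ComplexOrder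
open Literature.AlgebraicGeometry.Motives (SchemeOver)
open Literature.NumberTheory.Automorphic Literature.NumberTheory.Automorphic.UnitaryGroup
open Literature.NumberTheory.Automorphic.ShimuraDissection
open Literature.NumberTheory.Automorphic.Liu2021.AppendixC (C5.OpenCompactSubgroup C5.SmallLevel)

namespace Literature.AlgebraicGeometry.ShimuraVarieties

namespace UnitaryCanonicalModel

variable {L : Type} [Field L] [NumberField L] [IsCMField L] {Jstar : Matrix (Fin 2) (Fin 2) L} {τ : L →+* ℂ}
variable {K₀ : C5.OpenCompactSubgroup ↥(finAdelic (↥(maximalRealSubfield L)) L (IsCMField.complexConj L) 2 Jstar)}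

/-! ### §1 Glue: frames, conjugation, determinants (the L5 leaf's §2, private) -/

/-- The signature matrix is real: entrywise complex conjugation fixes it. [folklore] -/
private theorem signatureMatrix_map_conj (p : ℕ) : (signatureMatrix p).map (starRingEnd ℂ) = signatureMatrix p := by
  ext i j
  simp only [signatureMatrix, Matrix.map_apply, Matrix.diagonal_apply]
  split_ifs <;> simp

/-- Conjugating a frame: if `J` has signature `(1,1)` in the frame `T`, then the entrywise conjugate `J̄` has signature `(1,1)` in
the frame `T̄`. [folklore] -/
private theorem exists_frame_conj {J : Matrix (Fin 2) (Fin 2) ℂ}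
    (h : ∃ T : GL (Fin 2) ℂ, (T : Matrix (Fin 2) (Fin 2) ℂ)ᴴ * J * (T : Matrix (Fin 2) (Fin 2) ℂ) = signatureMatrix 1) :
    ∃ T : GL (Fin 2) ℂ, (T : Matrix (Fin 2) (Fin 2) ℂ)ᴴ * J.map (starRingEnd ℂ) * (T : Matrix (Fin 2) (Fin 2) ℂ) = signatureMatrix 1 := by
  obtain ⟨T, hT⟩ := h
  refine ⟨Matrix.GeneralLinearGroup.map (starRingEnd ℂ) T, ?_⟩
  have hc : ((Matrix.GeneralLinearGroup.map (starRingEnd ℂ) T : GL (Fin 2) ℂ) : Matrix (Fin 2) (Fin 2) ℂ) =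
      (T : Matrix (Fin 2) (Fin 2) ℂ).map (starRingEnd ℂ) := by
    ext i j; simp [Matrix.GeneralLinearGroup.map_apply]
  have hct : ((T : Matrix (Fin 2) (Fin 2) ℂ).map (starRingEnd ℂ))ᴴ = ((T : Matrix (Fin 2) (Fin 2) ℂ)ᴴ).map (starRingEnd ℂ) := by
    ext i j; simp [Matrix.conjTranspose_apply, Matrix.map_apply]
  rw [hc, hct, ← Matrix.map_mul, ← Matrix.map_mul, hT, signatureMatrix_map_conj]

/-- `J⋆^{τ̄}` is the entrywise conjugate of `J⋆^{τ}`. [folklore] -/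
private theorem map_conjugate_eq {F : Type} [Field F] (ι : F →+* ℂ) (J : Matrix (Fin 2) (Fin 2) F) :
    J.map (ComplexEmbedding.conjugate ι) = (J.map ι).map (starRingEnd ℂ) := by
  ext i j
  simp [Matrix.map_apply, ComplexEmbedding.conjugate_coe_eq]

/-- `det H_{1,1} = -1`. [folklore] -/
private theorem det_signatureMatrix_one : (signatureMatrix 1).det = -1 := by
  simp [signatureMatrix, Matrix.det_diagonal, Fin.prod_univ_two, Fin.ext_iff]

/-- A `2 × 2` complex matrix congruent to `H_{1,1}` has NEGATIVE REAL determinant: `det (Tᴴ J T) = |det T|² · det J = −1`. [folklore] -/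
private theorem det_re_neg_of_frame {J : Matrix (Fin 2) (Fin 2) ℂ}
    (h : ∃ T : GL (Fin 2) ℂ, (T : Matrix (Fin 2) (Fin 2) ℂ)ᴴ * J * (T : Matrix (Fin 2) (Fin 2) ℂ) = signatureMatrix 1) : J.det.re < 0 := by
  obtain ⟨T, hT⟩ := h
  have hdet := congrArg Matrix.det hT
  rw [Matrix.det_mul, Matrix.det_mul, Matrix.det_conjTranspose, det_signatureMatrix_one] at hdet
  set d : ℂ := (T : Matrix (Fin 2) (Fin 2) ℂ).det with hd
  have hd0 : d ≠ 0 := by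
    intro h0
    rw [h0] at hdet
    norm_num at hdet
  have hprod : star d * J.det * d = J.det * (Complex.normSq d : ℂ) := by
    rw [← Complex.mul_conj, mul_comm (star d), mul_assoc, mul_comm (star d) d]
    rfl
  have hre : J.det.re * Complex.normSq d = -1 := by
    have := congrArg Complex.re (hprod.symm.trans hdet)
    simpa [Complex.mul_re] using this
  nlinarith [Complex.normSq_pos.mpr hd0]

/-! ### §2 Case (3) is empty -/

/-- **«CASE (3) IS EMPTY» — no complex embedding off the place of `τ` reads `J⋆` as `τ` or `τ̄` does** (SIG-AUDIT «M-42» (b) case (3),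
the content of the E-line socket `stub_SIG` off the print signature).  For a record `S` of the unitary Shimura curve of a
HERMITIAN `J⋆` at ANY small level `Kc`, and `σ` with `mk σ ≠ mk τ`: `J⋆^σ ≠ J⋆^τ` and `J⋆^σ ≠ J⋆^τ̄`.  Proof: otherwise `J⋆^σ` is
congruent to `H_{1,1}` like `J⋆^τ` (★ `exists_conjTranspose_mul_map_mul_eq_signatureMatrix_one`; conjugate frame for `τ̄`), so
`det(J⋆^τ).re < 0` and `det(J⋆^σ).re < 0`; the open level `Kc` contains a principal level `K_{U,f}(n)` (★
`exists_finCongruenceLevel_span_subset`), so `Γ_{J⋆}(n) ≤ Γ_{J⋆}(Kc)` (★ `arithmeticLevel_finCongruenceLevel_span`, `arithmeticLevel_mono`);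
★ `TwoIndefinitePlaces.infinite_setOf_mem_principalCongruenceSubgroup_norm_le` gives infinitely many `τ`-bounded elements of
`Γ_{J⋆}(n)` while ★ `RecordSystemGS.finite_setOf_mem_norm_le_of_le_arithmeticLevel` says there are finitely many.
[cite: Liu2021, App. C §C.1 p. 107; Rem. C.2 p. 108] [cite: Borel1969, §1 and Prop. 7.13]
[cite: Deligne1979ShimuraVarieties, 2.1.2] -/
theorem RecordSystemGS.map_ne_and_map_ne_conjugate_of_mk_ne (S : RecordSystemGS L Jstar τ K₀) (Kc : C5.SmallLevel K₀)
    (hJ : (Jstar.map (IsCMField.complexConj L))ᵀ = Jstar) (σ : L →+* ℂ) (hσ : InfinitePlace.mk σ ≠ InfinitePlace.mk τ) :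
    Jstar.map σ ≠ Jstar.map τ ∧ Jstar.map σ ≠ Jstar.map (ComplexEmbedding.conjugate τ) := by
  classical
  by_contra hcase
  -- (1,1) at `τ` (★ `UnitaryShimuraCurveRecordSignature`) and, in case (3), at `σ`
  have h11 : ∃ T : GL (Fin 2) ℂ, (T : Matrix (Fin 2) (Fin 2) ℂ)ᴴ * Jstar.map τ * (T : Matrix (Fin 2) (Fin 2) ℂ) = signatureMatrix 1 :=
    S.exists_conjTranspose_mul_map_mul_eq_signatureMatrix_one Kc
  have h11σ : ∃ T : GL (Fin 2) ℂ, (T : Matrix (Fin 2) (Fin 2) ℂ)ᴴ * Jstar.map σ * (T : Matrix (Fin 2) (Fin 2) ℂ) = signatureMatrix 1 := by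
    rcases not_and_or.mp hcase with h | h
    · rw [not_ne_iff.mp h]; exact h11
    · rw [not_ne_iff.mp h, map_conjugate_eq]; exact exists_frame_conj h11
  have hd₁ : (Jstar.map τ).det.re < 0 := det_re_neg_of_frame h11
  have hdσ : (Jstar.map σ).det.re < 0 := det_re_neg_of_frame h11σ
  -- a principal level inside the small level `Kc`
  obtain ⟨n, hn, hKn⟩ := exists_finCongruenceLevel_span_subset (F := ↥(maximalRealSubfield L)) (E := L)
    (c := IsCMField.complexConj L) (N := 2) (J := Jstar)
    (U := (Kc.1.1 : Set ↥(finAdelic (↥(maximalRealSubfield L)) L (IsCMField.complexConj L) 2 Jstar)))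
    (Kc.1.2.1.mem_nhds (one_mem _))
  have hle : principalCongruenceSubgroup ((IsCMField.complexConj L : L ≃ₐ[↥(maximalRealSubfield L)] L) : L →+* L) Jstar n ≤
      arithmeticLevel ↥(maximalRealSubfield L) L (IsCMField.complexConj L) 2 Jstar Kc.1.1 := by
    rw [← arithmeticLevel_finCongruenceLevel_span hn]
    exact arithmeticLevel_mono fun x hx => hKn hx
  -- two indefinite places: infinitely many `τ`-bounded elements of `Γ(n)`; the record: finitely many — contradiction
  obtain ⟨C, hinf⟩ :=
    TwoIndefinitePlaces.infinite_setOf_mem_principalCongruenceSubgroup_norm_le L τ σ Jstar hJ hd₁ hdσ hσ hn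
  exact hinf (S.finite_setOf_mem_norm_le_of_le_arithmeticLevel Kc hle C)

/-! ### §3 The signature datum -/

/-- **THE SIGNATURE DATUM OF A UNITARY SHIMURA-CURVE RECORD** ([Liu2021] App. C §C.1 p. 107, Rem. C.2 p. 108: signature `(n−1, 1)` at
`τ`, `(n, 0)` elsewhere, `n = 2`; the E-line's `SigDatum L τ J⋆` VERBATIM, with the trivial rescaling `t = 1`): for a record `S` of a
hermitian `J⋆` and any small level `Kc` there is `t : L` with `τ t` real positive such that `t•J⋆` has signature `(1,1)` at `τ`
(`∃ T ∈ GL₂(ℂ), Tᴴ (t•J⋆)^τ T = diag(1,−1)`) and is POSITIVE DEFINITE at every complex embedding `σ` off the place of `τ` — ★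
`exists_sigDatum_one_of_forall_ne` fed by «case (3) = ∅».  The E-line pays its socket by
`theorem stub_SIG : RecordSignatureDatumOfSystem := fun F _ _ _ _ ι₁ Jstar hJ _hJu K₀ S Kc => S.exists_sigDatum Kc hJ`.
[cite: Liu2021, App. C §C.1 p. 107; Rem. C.2 p. 108] [cite: RapoportSmithlingZhang2020Diagonal, §3.1 p. 8] -/
theorem RecordSystemGS.exists_sigDatum (S : RecordSystemGS L Jstar τ K₀) (Kc : C5.SmallLevel K₀)
    (hJ : (Jstar.map (IsCMField.complexConj L))ᵀ = Jstar) :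
    ∃ t : L, 0 < (τ t).re ∧ (τ t).im = 0 ∧
      (∃ T : GL (Fin 2) ℂ, ((T : GL (Fin 2) ℂ) : Matrix (Fin 2) (Fin 2) ℂ)ᴴ * (t • Jstar).map τ * (T : Matrix (Fin 2) (Fin 2) ℂ) =
        signatureMatrix 1) ∧
      ∀ σ : L →+* ℂ, InfinitePlace.mk σ ≠ InfinitePlace.mk τ → ((t • Jstar).map σ).PosDef :=
  S.exists_sigDatum_one_of_forall_ne Kc (S.map_ne_and_map_ne_conjugate_of_mk_ne Kc hJ)

end UnitaryCanonicalModel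

end Literature.AlgebraicGeometry.ShimuraVarieties

end
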